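import Literature.Analysis.FluidPDE.OnsagerBDSVTorusPrimitives
import Literature.Analysis.FluidPDE.OnsagerBDSVEnergyTools
import Literature.Analysis.FluidPDE.OnsagerBDSVPerturbationFlowBounds
import Literature.Analysis.FunctionSpaces.ContDiffHolderLeibniz
import HarnessLib

/-!
# The non-stationary phase bound behind BDSV Prop. 6.2 (K-fold integration by parts)

Buckmaster–De Lellis–Székelyhidi–Vicol (BDSV), *Onsager's conjecture for admissible weak
solutions*, CPAM 72 (2019) = arXiv:1701.08678. The oscillatory term of the energy (proof of
Prop. 6.2, last paragraph) is an integral `∫_{T³} f(x) u(R̃(x), n Φ(x)) dx` of a slowly varying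
amplitude `f` (`‖f‖_{C^k} ≲ δ_{q+1} ℓ^{-k}`) against the mean-free Mikado tensor `u = W ⊗ W - R`
composed with the conjugated stress `R̃ = R̃_{q,i}` and the fast phase `n Φ = n_{q+1} Φ_i`,
`Φ = id + D`. BDSV bound it by Fourier expansion in `ξ` and the stationary-phase estimate
(C.1) of Prop. C.2, `|∫ a e^{ik·Φ}| ≲ (‖a‖_N + ‖a‖₀‖Φ‖_N)/|k|^N` (Daneri–Székelyhidi 2017,
Lemma 2.2: `N` integrations by parts). This file proves the same mechanism directly for the
composite, with all constants explicit:

* `BDSV.phaseComp u R̃ D n (x) = u(R̃(x), n(x + D(x)))` and its **chain rule**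
  (`BDSV.partialDeriv_phaseComp`):
  `∂_m c_u = ∑_{a,b} ∂_m R̃_{ab} c_{∂_{R_{ab}}u} + n ∑_k (∇Φ)_{km} c_{∂_{ξ_k}u}`, `∇Φ = BDSV.jac D`;
* **one integration by parts against the fast phase** (`BDSV.integral_mul_phaseComp_dXi`): with
  `A = adj ∇Φ = ∇Φ⁻¹` (`det ∇Φ = 1`),
  `∫ f c_{∂_{ξ_j}v} = -n⁻¹(∑_m ∫ ∂_m(f A_{mj}) c_v + ∑_{m,a,b} ∫ f A_{mj} ∂_mR̃_{ab} c_{∂_{R_{ab}}v})`;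
* **scaled `C^N` bounds** `BDSV.ScaledBound g N ℓ M` (`‖g‖_{C^j} ≤ M ℓ^{-j}`, `j ≤ N`, norms
  `Torus.eContDiffHolderNorm j 0`) and their algebra (sum, product = Leibniz (A.2) via
  `Torus.eContDiffHolderNorm_bilinear_le`, derivative costs `ℓ⁻¹`);
* the **`K`-step bound** (`BDSV.PhaseFrame.levelBound`): in a `BDSV.PhaseFrame` (smooth `R̃` with
  values in a compact `𝒦`, smooth `D` with `det ∇Φ = 1`, `n ≥ 1`, `0 < ℓ ≤ 1`, and
  `‖(adj ∇Φ)_{mj}‖_{C^k}, ‖R̃_{ab}‖_{C^k} ≤ Λ ℓ^{-k}` for `k ≤ K₀`), for every `K ≤ K₀`, every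
  jointly smooth zero-mean profile `u` and smooth `f` with `BDSV.ScaledBound f K ℓ F`,
  `|∫ f c_u| ≤ (phaseConst K₀ · Λ² · (nℓ)⁻¹)^K · F · U`, `U` a uniform bound of the level-`K`
  descendants of `u` (`BDSV.descSet`: the profiles reached by `K` rounds of a zero-mean primitive
  `Tⱼ` of `OnsagerBDSVTorusPrimitives.lean` possibly followed by one `R`-derivative) on `𝒦 × T³`
  (`BDSV.exists_bound_descSet`: they are finitely many continuous functions). Proof: induction on
  `K`; at each step `u = ∑ⱼ ∂ⱼ(Tⱼ u)` (`BDSV.eq_sum_partialDeriv_torusPrim`) and one integration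
  by parts; ninety terms, each again of the same shape one level down.

The assembly with the objects of the construction is `OnsagerBDSVEnergyPrincipalProofs.lean`.

## References

* T. Buckmaster, C. De Lellis, L. Székelyhidi Jr., V. Vicol, *Onsager's conjecture for admissible
  weak solutions*, Comm. Pure Appl. Math. 72 (2019) 229–274 = arXiv:1701.08678: proof of
  Prop. 6.2 (last paragraph); App. C Prop. C.2 (C.1); App. A (A.2); §5.2 (`Φ_i`, `∇Φ_i`).
* S. Daneri, L. Székelyhidi Jr., *Non-uniqueness and h-principle for Hölder-continuous weak
  solutions of the Euler equations*, ARMA 224 (2017), Lemma 2.2 (the integration-by-parts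
  mechanism).
-/

open MeasureTheory Set Filter
open scoped NNReal ENNReal ContDiff Matrix Matrix.Norms.Elementwise

noncomputable section

namespace Literature.Analysis.FluidPDE

namespace BDSV

open FunctionSpaces FunctionSpaces.Torus

/-- The flat three-torus `T³ = (ℝ/ℤ)³`, local notation. -/
local notation "𝕋³" => UnitAddTorus (Fin 3)

/-- Euclidean `ℝ³`, local notation. -/
local notation "ℝ³" => EuclideanSpace ℝ (Fin 3)

/-- Real `3 × 3` matrices, local notation. -/
local notation "𝕄" => Matrix (Fin 3) (Fin 3) ℝ

/-! ## The composite `x ↦ u(R̃(x), n Φ(x))` and its derivatives -/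

section Composite

variable {u : 𝕄 → 𝕋³ → ℝ} {Rt : 𝕋³ → 𝕄} {D : 𝕋³ → ℝ³}

/-- The deformation matrix `∇Φ = Id + ∇D` of `Φ = id + D` (entries `δ_{ab} + ∂_b D_a`; for the
backward flows of the construction this is `BDSV.gradPhi`). [cite: BuckmasterEtAl2018, §5.2 (Φ_i)] -/
def jac (D : 𝕋³ → ℝ³) (x : 𝕋³) : 𝕄 := 1 + Matrix.of fun a b => partialDeriv b D x a

/-- **The composite** `c_u(x) = u(R̃(x), n Φ(x))`, `Φ(x) = x + D(x) (mod ℤ³)`, of a parametrised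
profile with a matrix field `R̃` and the fast phase `n Φ` — the shape of every integrand
`ρ ∇Φ⁻¹ C_k(R̃) ∇Φ⁻ᵀ e^{iλ k·Φ}` in the proof of BDSV Prop. 6.2.
[cite: BuckmasterEtAl2018, Prop. 6.2 (proof)] -/
def phaseComp (u : 𝕄 → 𝕋³ → ℝ) (Rt : 𝕋³ → 𝕄) (D : 𝕋³ → ℝ³) (n : ℕ) (x : 𝕋³) : ℝ :=
  u (Rt x) (n • (x + proj (D x)))

/-- The lift of the composite factors through the joint lift of `u`:
`c_u (proj y) = û (R̃(proj y), n (y + D̂(y)))`. [folklore] -/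
theorem lift_phaseComp (u : 𝕄 → 𝕋³ → ℝ) (Rt : 𝕋³ → 𝕄) (D : 𝕋³ → ℝ³) (n : ℕ) :
    lift (phaseComp u Rt D n) =
      fun y => (fun p : 𝕄 × ℝ³ => u p.1 (proj p.2)) (lift Rt y, (n : ℝ) • (y + lift D y)) := by
  funext y
  simp only [lift_apply, phaseComp]
  rw [Nat.cast_smul_eq_nsmul, proj_nsmul, proj_add]

/-- Pointwise form of `BDSV.lift_phaseComp`. [folklore] -/
theorem phaseComp_proj (u : 𝕄 → 𝕋³ → ℝ) (Rt : 𝕋³ → 𝕄) (D : 𝕋³ → ℝ³) (n : ℕ) (y : ℝ³) :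
    phaseComp u Rt D n (proj y) = u (lift Rt y) (proj ((n : ℝ) • (y + lift D y))) := by
  have h := congrFun (lift_phaseComp u Rt D n) y
  rw [lift_apply] at h
  exact h

/-- The composite of a jointly smooth profile with smooth fields is smooth. [folklore] -/
theorem JointSmooth.phaseComp (hu : JointSmooth u) (hRt : IsSmooth Rt) (hD : IsSmooth D) (n : ℕ) :
    IsSmooth (BDSV.phaseComp u Rt D n) := by
  unfold IsSmooth
  rw [lift_phaseComp]
  exact hu.comp (hRt.prodMk ((contDiff_id.add hD).const_smul (n : ℝ)))

/-- Products of smooth real functions on `T³` are smooth (dot-notation extension of the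
`Torus.IsSmooth` API of `FunctionSpaces/FlatTorus.lean`, declared from here). [folklore] -/
theorem _root_.Literature.Analysis.FunctionSpaces.Torus.IsSmooth.mul {f g : 𝕋³ → ℝ}
    (hf : IsSmooth f) (hg : IsSmooth g) : IsSmooth fun x => f x * g x :=
  ContDiff.mul hf hg

/-- Entries of a smooth matrix field are smooth. [folklore] -/
theorem isSmooth_entry (hRt : IsSmooth Rt) (a b : Fin 3) : IsSmooth fun x => Rt x a b :=
  hRt.comp_clm ((ContinuousLinearMap.proj b).comp
    (ContinuousLinearMap.proj (R := ℝ) (φ := fun _ : Fin 3 => Fin 3 → ℝ) a))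

/-- The entries of `∇Φ = Id + ∇D` are smooth for smooth `D`. [folklore] -/
theorem isSmooth_jac_entry (hD : IsSmooth D) (k m : Fin 3) : IsSmooth fun x => jac D x k m := by
  have h : IsSmooth fun x => (1 : 𝕄) k m + partialDeriv m (fun y => D y k) x :=
    (isSmooth_const _).add ((hD.apply k).partialDeriv m)
  have heq : (fun x => jac D x k m) = fun x => (1 : 𝕄) k m + partialDeriv m (fun y => D y k) x := by
    funext x
    simp only [jac, Matrix.add_apply, Matrix.of_apply, partialDeriv_apply_eq hD m k x]
  rw [heq]
  exact h

/-- The entries of the adjugate `adj ∇Φ` are smooth (polynomials in the entries of `∇Φ`). [folklore] -/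
theorem isSmooth_adjugate_jac_entry (hD : IsSmooth D) (m j : Fin 3) :
    IsSmooth fun x => (jac D x).adjugate m j := by
  have hJ := isSmooth_jac_entry hD
  have hP : ∀ a b c d : Fin 3, IsSmooth fun x => jac D x a b * jac D x c d := fun a b c d =>
    (hJ a b).mul (hJ c d)
  fin_cases m <;> fin_cases j <;>
    simp only [Matrix.adjugate_fin_three, Matrix.of_apply, Matrix.cons_val', Matrix.cons_val_fin_one,
      Matrix.empty_val'] <;>
    first
    | exact (hP _ _ _ _).sub (hP _ _ _ _)
    | exact ((hP _ _ _ _).neg).add (hP _ _ _ _)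

/-! ### The chain rule for the composite -/

/-- The `R`-directional part of `D û` is the sum of the entrywise `R`-derivatives. [folklore] -/
theorem fderiv_jointLift_matrix (hu : JointSmooth u) (R M : 𝕄) (z : ℝ³) :
    fderiv ℝ (fun p : 𝕄 × ℝ³ => u p.1 (proj p.2)) (R, z) (M, 0) =
      ∑ a, ∑ b, M a b * dR (Matrix.single a b 1) u R (proj z) := by
  set L := fderiv ℝ (fun p : 𝕄 × ℝ³ => u p.1 (proj p.2)) (R, z) with hL
  have hM : ((M, 0) : 𝕄 × ℝ³) = ∑ a, ∑ b, M a b • ((Matrix.single a b (1 : ℝ), 0) : 𝕄 × ℝ³) := by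
    refine Prod.ext ?_ ?_
    · simp only [Prod.fst_sum, Prod.smul_fst, Matrix.smul_single, smul_eq_mul, mul_one]
      exact Matrix.matrix_eq_sum_single M
    · simp only [Prod.snd_sum, Prod.smul_snd, smul_zero, Finset.sum_const_zero]
  rw [hM, map_sum]
  refine Finset.sum_congr rfl fun a _ => ?_
  rw [map_sum]
  refine Finset.sum_congr rfl fun b _ => ?_
  rw [map_smul, smul_eq_mul, hu.dR_apply]

/-- The `ξ`-directional part of `D û` is the sum of the `ξ`-partial derivatives. [folklore] -/
theorem fderiv_jointLift_vector (hu : JointSmooth u) (R : 𝕄) (z w : ℝ³) :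
    fderiv ℝ (fun p : 𝕄 × ℝ³ => u p.1 (proj p.2)) (R, z) (0, w) =
      ∑ k, w k * dXi k u R (proj z) := by
  have hw : ((0, w) : 𝕄 × ℝ³) = ∑ k, w k • ((0, bvec k) : 𝕄 × ℝ³) := by
    refine Prod.ext ?_ ?_
    · simp only [Prod.fst_sum, Prod.smul_fst, smul_zero, Finset.sum_const_zero]
    · simp only [Prod.snd_sum, Prod.smul_snd]
      exact eq_sum_smul_bvec w
  rw [hw, map_sum]
  refine Finset.sum_congr rfl fun k _ => ?_
  rw [map_smul, smul_eq_mul, hu.dXi_apply]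

/-- The derivative of the lifted matrix field in the direction `e_m` has entries
`∂_m R̃_{ab}`. [folklore] -/
theorem fderiv_lift_matrix_apply (hRt : IsSmooth Rt) (y : ℝ³) (m a b : Fin 3) :
    fderiv ℝ (lift Rt) y (bvec m) a b = partialDeriv m (fun x => Rt x a b) (proj y) := by
  set Lab : 𝕄 →L[ℝ] ℝ := (ContinuousLinearMap.proj b).comp
    (ContinuousLinearMap.proj (R := ℝ) (φ := fun _ : Fin 3 => Fin 3 → ℝ) a) with hLab
  have hab : IsSmooth fun x => Rt x a b := isSmooth_entry hRt a b
  have hd : DifferentiableAt ℝ (lift Rt) y := (hRt.differentiable (by simp)) y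
  have hcomp : fderiv ℝ (lift fun x => Rt x a b) y = Lab.comp (fderiv ℝ (lift Rt) y) := by
    have h1 : lift (fun x => Rt x a b) = fun y => Lab (lift Rt y) := rfl
    rw [h1]
    exact (Lab.hasFDerivAt.comp y hd.hasFDerivAt).fderiv
  rw [partialDeriv_eq_fderiv_apply (hab.isContDiff (by simp)), ← fderiv_lift, hcomp]
  rfl

/-- **Chain rule for the composite**: for jointly smooth `u` and smooth `R̃`, `D`,
`∂_m c_u = ∑_{a,b} ∂_m R̃_{ab} · c_{∂_{R_{ab}} u} + n ∑_k (∇Φ)_{km} · c_{∂_{ξ_k} u}`.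
[folklore] -/
theorem partialDeriv_phaseComp (hu : JointSmooth u) (hRt : IsSmooth Rt) (hD : IsSmooth D) (n : ℕ)
    (m : Fin 3) (x : 𝕋³) :
    partialDeriv m (phaseComp u Rt D n) x =
      (∑ a, ∑ b, partialDeriv m (fun y => Rt y a b) x *
          phaseComp (dR (Matrix.single a b 1) u) Rt D n x) +
        n * ∑ k, jac D x k m * phaseComp (dXi k u) Rt D n x := by
  obtain ⟨y, rfl⟩ := proj_surjective x
  have hc : IsSmooth (phaseComp u Rt D n) := hu.phaseComp hRt hD n
  -- the map `Ψ(y) = (R̃(proj y), n (y + D̂ y))` and its derivative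
  set Ψ : ℝ³ → 𝕄 × ℝ³ := fun y => (lift Rt y, (n : ℝ) • (y + lift D y)) with hΨ
  set LΨ : ℝ³ →L[ℝ] 𝕄 × ℝ³ := (fderiv ℝ (lift Rt) y).prod
    ((n : ℝ) • (ContinuousLinearMap.id ℝ ℝ³ + fderiv ℝ (lift D) y)) with hLΨ
  have hRtd : HasFDerivAt (lift Rt) (fderiv ℝ (lift Rt) y) y :=
    ((hRt.differentiable (by simp)) y).hasFDerivAt
  have hDd : HasFDerivAt (lift D) (fderiv ℝ (lift D) y) y :=
    ((hD.differentiable (by simp)) y).hasFDerivAt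
  have hΨd : HasFDerivAt Ψ LΨ y := hRtd.prodMk (((hasFDerivAt_id y).add hDd).const_smul (n : ℝ))
  have hûd : HasFDerivAt (fun p : 𝕄 × ℝ³ => u p.1 (proj p.2))
      (fderiv ℝ (fun p : 𝕄 × ℝ³ => u p.1 (proj p.2)) (Ψ y)) (Ψ y) :=
    ((hu.differentiable (by simp)) (Ψ y)).hasFDerivAt
  have hcomp : HasFDerivAt
      (fun y => (fun p : 𝕄 × ℝ³ => u p.1 (proj p.2)) (lift Rt y, (n : ℝ) • (y + lift D y)))
      ((fderiv ℝ (fun p : 𝕄 × ℝ³ => u p.1 (proj p.2)) (Ψ y)).comp LΨ) y :=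
    hûd.comp y hΨd
  rw [partialDeriv_eq_fderiv_apply (hc.isContDiff (by simp)), ← fderiv_lift, lift_phaseComp,
    hcomp.fderiv, ContinuousLinearMap.comp_apply]
  -- evaluate `LΨ e_m`
  have hLe : LΨ (bvec m) = ((fderiv ℝ (lift Rt) y (bvec m), 0) : 𝕄 × ℝ³) +
      ((0, (n : ℝ) • (bvec m + fderiv ℝ (lift D) y (bvec m))) : 𝕄 × ℝ³) := by
    rw [hLΨ, ContinuousLinearMap.prod_apply, Prod.mk_add_mk, add_zero, zero_add]
    rfl
  change (fderiv ℝ (fun p : 𝕄 × ℝ³ => u p.1 (proj p.2)) (Ψ y)) (LΨ (bvec m)) = _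
  rw [hLe, map_add, show ((0, (n : ℝ) • (bvec m + fderiv ℝ (lift D) y (bvec m))) : 𝕄 × ℝ³) =
      (n : ℝ) • ((0, bvec m + fderiv ℝ (lift D) y (bvec m)) : 𝕄 × ℝ³) by
        rw [Prod.smul_mk, smul_zero], map_smul, smul_eq_mul]
  have hΨy : Ψ y = (lift Rt y, (n : ℝ) • (y + lift D y)) := rfl
  rw [hΨy, fderiv_jointLift_matrix hu, fderiv_jointLift_vector hu]
  congr 1
  · refine Finset.sum_congr rfl fun a _ => Finset.sum_congr rfl fun b _ => ?_
    rw [fderiv_lift_matrix_apply hRt, phaseComp_proj, lift_apply]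
  · congr 1
    refine Finset.sum_congr rfl fun k _ => ?_
    rw [phaseComp_proj, lift_apply]
    congr 1
    -- `(e_m + D(lift D)(y) e_m)_k = (∇Φ)_{km}`
    have h1 : fderiv ℝ (lift D) y (bvec m) k = partialDeriv m D (proj y) k := by
      rw [partialDeriv_eq_fderiv_apply (hD.isContDiff (by simp)), ← fderiv_lift]
      rfl
    have h2 : (bvec m) k = if k = m then (1 : ℝ) else 0 := by
      simp [bvec, PiLp.single_apply]
    simp only [jac, Matrix.add_apply, Matrix.of_apply, Matrix.one_apply, PiLp.add_apply, h1, h2]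

end Composite

/-! ## One integration by parts against the fast phase -/

section Step

variable {v : 𝕄 → 𝕋³ → ℝ} {Rt : 𝕋³ → 𝕄} {D : 𝕋³ → ℝ³} {f : 𝕋³ → ℝ}

/-- `∑_m (∇Φ)_{km} (adj ∇Φ)_{mj} = δ_{kj}` when `det ∇Φ = 1`. [folklore] -/
theorem sum_jac_mul_adjugate {x : 𝕋³} (hdet : (jac D x).det = 1) (k j : Fin 3) :
    ∑ m, jac D x k m * (jac D x).adjugate m j = if k = j then 1 else 0 := by
  have h := congrFun (congrFun (Matrix.mul_adjugate (jac D x)) k) j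
  rw [Matrix.mul_apply, hdet, one_smul, Matrix.one_apply] at h
  exact h

/-- **Trading a fast derivative for slow ones** (pointwise): with `A = adj ∇Φ = ∇Φ⁻¹`,
`n c_{∂_{ξ_j} v} = ∑_m A_{mj} ∂_m c_v - ∑_{m,a,b} A_{mj} ∂_m R̃_{ab} c_{∂_{R_{ab}} v}` — the chain
rule solved for the `ξ`-derivative. [cite: BuckmasterEtAl2018, App. C Prop. C.2 (proof of (C.1))] -/
theorem cast_mul_phaseComp_dXi (hv : JointSmooth v) (hRt : IsSmooth Rt) (hD : IsSmooth D) (n : ℕ)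
    {x : 𝕋³} (hdet : (jac D x).det = 1) (j : Fin 3) :
    (n : ℝ) * phaseComp (dXi j v) Rt D n x =
      (∑ m, (jac D x).adjugate m j * partialDeriv m (phaseComp v Rt D n) x) -
        ∑ m, ∑ a, ∑ b, (jac D x).adjugate m j * partialDeriv m (fun y => Rt y a b) x *
          phaseComp (dR (Matrix.single a b 1) v) Rt D n x := by
  have hchain : ∀ m, partialDeriv m (phaseComp v Rt D n) x =
      (∑ a, ∑ b, partialDeriv m (fun y => Rt y a b) x *
          phaseComp (dR (Matrix.single a b 1) v) Rt D n x) +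
        n * ∑ k, jac D x k m * phaseComp (dXi k v) Rt D n x := fun m =>
    partialDeriv_phaseComp hv hRt hD n m x
  have hmid : ∀ m, (jac D x).adjugate m j * partialDeriv m (phaseComp v Rt D n) x =
      (jac D x).adjugate m j * (∑ a, ∑ b, partialDeriv m (fun y => Rt y a b) x *
          phaseComp (dR (Matrix.single a b 1) v) Rt D n x) +
        n * ∑ k, (jac D x k m * (jac D x).adjugate m j) * phaseComp (dXi k v) Rt D n x := by
    intro m
    have e1 : (jac D x).adjugate m j * ((n : ℝ) * ∑ k, jac D x k m * phaseComp (dXi k v) Rt D n x) =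
        n * ∑ k, (jac D x k m * (jac D x).adjugate m j) * phaseComp (dXi k v) Rt D n x := by
      rw [Finset.mul_sum, Finset.mul_sum, Finset.mul_sum]
      exact Finset.sum_congr rfl fun k _ => by ring
    rw [hchain m, mul_add, e1]
  have hswap : ∑ m, (n : ℝ) * ∑ k, (jac D x k m * (jac D x).adjugate m j) *
      phaseComp (dXi k v) Rt D n x = n * phaseComp (dXi j v) Rt D n x := by
    rw [← Finset.mul_sum, Finset.sum_comm]
    congr 1
    have h3 : ∀ k, ∑ m, jac D x k m * (jac D x).adjugate m j * phaseComp (dXi k v) Rt D n x =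
        (if k = j then 1 else 0) * phaseComp (dXi k v) Rt D n x := by
      intro k
      rw [← Finset.sum_mul, sum_jac_mul_adjugate hdet]
    simp only [h3, ite_mul, one_mul, zero_mul, Finset.sum_ite_eq', Finset.mem_univ, if_true]
  have h1 : ∑ m, (jac D x).adjugate m j * partialDeriv m (phaseComp v Rt D n) x =
      (∑ m, (jac D x).adjugate m j * ∑ a, ∑ b, partialDeriv m (fun y => Rt y a b) x *
          phaseComp (dR (Matrix.single a b 1) v) Rt D n x) +
        n * phaseComp (dXi j v) Rt D n x := by
    simp only [hmid]
    rw [Finset.sum_add_distrib, hswap]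
  have h4 : ∑ m, ∑ a, ∑ b, (jac D x).adjugate m j * partialDeriv m (fun y => Rt y a b) x *
      phaseComp (dR (Matrix.single a b 1) v) Rt D n x =
      ∑ m, (jac D x).adjugate m j * ∑ a, ∑ b, partialDeriv m (fun y => Rt y a b) x *
          phaseComp (dR (Matrix.single a b 1) v) Rt D n x := by
    refine Finset.sum_congr rfl fun m _ => ?_
    rw [Finset.mul_sum]
    refine Finset.sum_congr rfl fun a _ => ?_
    rw [Finset.mul_sum]
    refine Finset.sum_congr rfl fun b _ => ?_
    ring
  rw [h1, h4]
  ring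

/-- **One integration by parts against the fast phase**: for jointly smooth `v`, smooth `f`, `R̃`,
`D` with `det ∇Φ = 1` and `n ≠ 0`,
`∫ f c_{∂_{ξ_j} v} = -n⁻¹ (∑_m ∫ ∂_m(f A_{mj}) c_v + ∑_{m,a,b} ∫ f A_{mj} ∂_mR̃_{ab} c_{∂_{R_{ab}} v})`,
`A = adj ∇Φ` (the torus has no boundary). Iterated, this is the mechanism of the
non-stationary phase estimate (C.1). [cite: BuckmasterEtAl2018, App. C Prop. C.2 (C.1)] -/
theorem integral_mul_phaseComp_dXi (hv : JointSmooth v) (hRt : IsSmooth Rt) (hD : IsSmooth D)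
    (hdet : ∀ x, (jac D x).det = 1) (hf : IsSmooth f) {n : ℕ} (hn : n ≠ 0) (j : Fin 3) :
    ∫ x, f x * phaseComp (dXi j v) Rt D n x =
      -((n : ℝ)⁻¹ *
        ((∑ m, ∫ x, partialDeriv m (fun y => f y * (jac D y).adjugate m j) x *
            phaseComp v Rt D n x) +
          ∑ m, ∑ a, ∑ b, ∫ x, (f x * (jac D x).adjugate m j *
            partialDeriv m (fun y => Rt y a b) x) *
              phaseComp (dR (Matrix.single a b 1) v) Rt D n x)) := by
  have hn' : (n : ℝ) ≠ 0 := Nat.cast_ne_zero.2 hn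
  -- smoothness of the players
  have hA : ∀ m, IsSmooth fun x => (jac D x).adjugate m j := fun m =>
    isSmooth_adjugate_jac_entry hD m j
  have hfA : ∀ m, IsSmooth fun x => f x * (jac D x).adjugate m j := fun m => hf.mul (hA m)
  have hcv : IsSmooth (phaseComp v Rt D n) := hv.phaseComp hRt hD n
  have hcR : ∀ a b, IsSmooth (phaseComp (dR (Matrix.single a b 1) v) Rt D n) := fun a b =>
    (hv.dR _).phaseComp hRt hD n
  have hRab : ∀ m a b, IsSmooth fun x => partialDeriv m (fun y => Rt y a b) x := fun m a b =>
    (isSmooth_entry hRt a b).partialDeriv m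
  -- the pointwise identity, multiplied by `f` and divided by `n`
  have hpt : ∀ x, f x * phaseComp (dXi j v) Rt D n x =
      (n : ℝ)⁻¹ * ((∑ m, (f x * (jac D x).adjugate m j) *
          partialDeriv m (phaseComp v Rt D n) x) -
        ∑ m, ∑ a, ∑ b, (f x * (jac D x).adjugate m j * partialDeriv m (fun y => Rt y a b) x) *
          phaseComp (dR (Matrix.single a b 1) v) Rt D n x) := by
    intro x
    have h := cast_mul_phaseComp_dXi hv hRt hD n (hdet x) j
    have h' : phaseComp (dXi j v) Rt D n x = (n : ℝ)⁻¹ *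
        ((∑ m, (jac D x).adjugate m j * partialDeriv m (phaseComp v Rt D n) x) -
          ∑ m, ∑ a, ∑ b, (jac D x).adjugate m j * partialDeriv m (fun y => Rt y a b) x *
            phaseComp (dR (Matrix.single a b 1) v) Rt D n x) := by
      rw [← h, ← mul_assoc, inv_mul_cancel₀ hn', one_mul]
    rw [h', mul_left_comm, mul_sub, Finset.mul_sum, Finset.mul_sum]
    congr 2
    · refine Finset.sum_congr rfl fun m _ => ?_
      ring
    · refine Finset.sum_congr rfl fun m _ => ?_
      rw [Finset.mul_sum]
      refine Finset.sum_congr rfl fun a _ => ?_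
      rw [Finset.mul_sum]
      refine Finset.sum_congr rfl fun b _ => ?_
      ring
  -- integrability
  have hI1 : ∀ m, Integrable fun x => (f x * (jac D x).adjugate m j) *
      partialDeriv m (phaseComp v Rt D n) x := fun m =>
    ((hfA m).mul (hcv.partialDeriv m)).integrable
  have hI2 : ∀ m a b, Integrable fun x => (f x * (jac D x).adjugate m j *
      partialDeriv m (fun y => Rt y a b) x) * phaseComp (dR (Matrix.single a b 1) v) Rt D n x :=
    fun m a b => ((((hfA m)).mul (hRab m a b)).mul (hcR a b)).integrable
  have hI2ab : ∀ m a, Integrable fun x => ∑ b, (f x * (jac D x).adjugate m j *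
      partialDeriv m (fun y => Rt y a b) x) * phaseComp (dR (Matrix.single a b 1) v) Rt D n x :=
    fun m a => integrable_finsetSum _ fun b _ => hI2 m a b
  have hI2a : ∀ m, Integrable fun x => ∑ a, ∑ b, (f x * (jac D x).adjugate m j *
      partialDeriv m (fun y => Rt y a b) x) * phaseComp (dR (Matrix.single a b 1) v) Rt D n x :=
    fun m => integrable_finsetSum _ fun a _ => hI2ab m a
  -- integrate
  have hInt : ∫ x, f x * phaseComp (dXi j v) Rt D n x =
      (n : ℝ)⁻¹ * ((∑ m, ∫ x, (f x * (jac D x).adjugate m j) *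
          partialDeriv m (phaseComp v Rt D n) x) -
        ∑ m, ∑ a, ∑ b, ∫ x, (f x * (jac D x).adjugate m j * partialDeriv m (fun y => Rt y a b) x) *
          phaseComp (dR (Matrix.single a b 1) v) Rt D n x) := by
    rw [show (fun x => f x * phaseComp (dXi j v) Rt D n x) = _ from funext hpt, integral_const_mul,
      integral_sub (integrable_finsetSum _ fun m _ => hI1 m) (integrable_finsetSum _ fun m _ => hI2a m),
      integral_finsetSum _ fun m _ => hI1 m, integral_finsetSum _ fun m _ => hI2a m]
    congr 2
    refine Finset.sum_congr rfl fun m _ => ?_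
    rw [integral_finsetSum _ fun a _ => hI2ab m a]
    refine Finset.sum_congr rfl fun a _ => ?_
    rw [integral_finsetSum _ fun b _ => hI2 m a b]
  -- integrate by parts in the first sum
  have hIBP : ∀ m, ∫ x, (f x * (jac D x).adjugate m j) * partialDeriv m (phaseComp v Rt D n) x =
      -∫ x, partialDeriv m (fun y => f y * (jac D y).adjugate m j) x * phaseComp v Rt D n x := by
    intro m
    rw [integral_partialDeriv_mul_eq_neg (hfA m) hcv m, neg_neg]
  rw [hInt]
  simp only [hIBP, Finset.sum_neg_distrib]
  ring

end Step

/-! ## Scaled `C^N` bounds and their algebra -/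

section Scaled

/-- **Scaled `C^N` bounds**: `‖g‖_{C^j} ≤ M ℓ^{-j}` for all `j ≤ N` (norms
`Torus.eContDiffHolderNorm j 0`) — the shape `‖·‖_N ≲ ℓ^{-N}` of all the estimates of BDSV §5.5
(Prop. 5.7). [cite: BuckmasterEtAl2018, Prop. 5.7] -/
def ScaledBound (g : 𝕋³ → ℝ) (N : ℕ) (ℓ M : ℝ) : Prop :=
  ∀ j ≤ N, Torus.eContDiffHolderNorm j 0 g ≤ ENNReal.ofReal (M * ℓ⁻¹ ^ j)

variable {f g : 𝕋³ → ℝ} {N N' : ℕ} {ℓ M M' M₁ M₂ : ℝ}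

/-- Fewer derivatives. [folklore] -/
theorem ScaledBound.mono_N (h : ScaledBound g N ℓ M) (hN : N' ≤ N) : ScaledBound g N' ℓ M :=
  fun j hj => h j (hj.trans hN)

/-- A larger constant. [folklore] -/
theorem ScaledBound.mono_M (h : ScaledBound g N ℓ M) (hM : M ≤ M') (hℓ : 0 < ℓ) :
    ScaledBound g N ℓ M' := fun j hj =>
  (h j hj).trans (ENNReal.ofReal_le_ofReal
    (mul_le_mul_of_nonneg_right hM (pow_nonneg (inv_nonneg.2 hℓ.le) j)))

/-- The sup bound contained in a scaled bound: `|g(x)| ≤ M`. [folklore] -/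
theorem ScaledBound.abs_le (h : ScaledBound g N ℓ M) (hM : 0 ≤ M) (x : 𝕋³) : |g x| ≤ M := by
  have h0 := h 0 (Nat.zero_le _)
  rw [pow_zero, mul_one] at h0
  have := norm_le_of_eContDiffHolderNorm_zero_le hM h0 x
  rwa [Real.norm_eq_abs] at this

/-- Scaled bounds add. [folklore] -/
theorem ScaledBound.add (hf : ScaledBound f N ℓ M₁) (hg : ScaledBound g N ℓ M₂) (hfs : IsSmooth f)
    (hgs : IsSmooth g) (h₁ : 0 ≤ M₁) (h₂ : 0 ≤ M₂) (hℓ : 0 < ℓ) :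
    ScaledBound (fun x => f x + g x) N ℓ (M₁ + M₂) := by
  intro j hj
  have hp : 0 ≤ ℓ⁻¹ ^ j := pow_nonneg (inv_nonneg.2 hℓ.le) j
  calc Torus.eContDiffHolderNorm j 0 (fun x => f x + g x)
      ≤ Torus.eContDiffHolderNorm j 0 f + Torus.eContDiffHolderNorm j 0 g :=
        Torus.eContDiffHolderNorm_add_le (hfs.isContDiff (by exact_mod_cast le_top))
          (hgs.isContDiff (by exact_mod_cast le_top))
    _ ≤ ENNReal.ofReal (M₁ * ℓ⁻¹ ^ j) + ENNReal.ofReal (M₂ * ℓ⁻¹ ^ j) := add_le_add (hf j hj) (hg j hj)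
    _ = ENNReal.ofReal ((M₁ + M₂) * ℓ⁻¹ ^ j) := by
        rw [← ENNReal.ofReal_add (mul_nonneg h₁ hp) (mul_nonneg h₂ hp), add_mul]

/-- Scaled bounds subtract. [folklore] -/
theorem ScaledBound.sub (hf : ScaledBound f N ℓ M₁) (hg : ScaledBound g N ℓ M₂) (hfs : IsSmooth f)
    (hgs : IsSmooth g) (h₁ : 0 ≤ M₁) (h₂ : 0 ≤ M₂) (hℓ : 0 < ℓ) :
    ScaledBound (fun x => f x - g x) N ℓ (M₁ + M₂) := by
  intro j hj
  have hp : 0 ≤ ℓ⁻¹ ^ j := pow_nonneg (inv_nonneg.2 hℓ.le) j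
  calc Torus.eContDiffHolderNorm j 0 (fun x => f x - g x)
      ≤ Torus.eContDiffHolderNorm j 0 f + Torus.eContDiffHolderNorm j 0 g :=
        Torus.eContDiffHolderNorm_sub_le (hfs.isContDiff (by exact_mod_cast le_top))
          (hgs.isContDiff (by exact_mod_cast le_top))
    _ ≤ ENNReal.ofReal (M₁ * ℓ⁻¹ ^ j) + ENNReal.ofReal (M₂ * ℓ⁻¹ ^ j) := add_le_add (hf j hj) (hg j hj)
    _ = ENNReal.ofReal ((M₁ + M₂) * ℓ⁻¹ ^ j) := by
        rw [← ENNReal.ofReal_add (mul_nonneg h₁ hp) (mul_nonneg h₂ hp), add_mul]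

/-- Scaled bounds under multiplication by a constant. [folklore] -/
theorem ScaledBound.const_mul (hf : ScaledBound f N ℓ M) (hfs : IsSmooth f) (c : ℝ) :
    ScaledBound (fun x => c * f x) N ℓ (|c| * M) := by
  intro j hj
  have h := Torus.eContDiffHolderNorm_const_smul (hfs.isContDiff (n := (j : ℕ)) (by exact_mod_cast le_top)) c
    (r := 0)
  calc Torus.eContDiffHolderNorm j 0 (fun x => c * f x)
      = Torus.eContDiffHolderNorm j 0 (c • f) := rfl
    _ = ‖c‖ₑ * Torus.eContDiffHolderNorm j 0 f := h
    _ ≤ ‖c‖ₑ * ENNReal.ofReal (M * ℓ⁻¹ ^ j) := mul_le_mul' le_rfl (hf j hj)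
    _ = ENNReal.ofReal (|c| * M * ℓ⁻¹ ^ j) := by
        rw [← ofReal_norm, Real.norm_eq_abs, ← ENNReal.ofReal_mul (abs_nonneg c), mul_assoc]

/-- **A derivative costs `ℓ⁻¹`**: `‖∂ᵢ g‖_{C^j} ≤ ‖g‖_{C^{j+1}} ≤ (M ℓ⁻¹) ℓ^{-j}`. [folklore] -/
theorem ScaledBound.partialDeriv (hg : ScaledBound g (N + 1) ℓ M) (hgs : IsSmooth g) (i : Fin 3) :
    ScaledBound (Torus.partialDeriv i g) N ℓ (M * ℓ⁻¹) := by
  intro j hj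
  calc Torus.eContDiffHolderNorm j 0 (Torus.partialDeriv i g)
      ≤ Torus.eContDiffHolderNorm (j + 1) 0 g :=
        Torus.eContDiffHolderNorm_partialDeriv_le (hgs.isContDiff (by exact_mod_cast le_top)) i 0
    _ ≤ ENNReal.ofReal (M * ℓ⁻¹ ^ (j + 1)) := hg (j + 1) (by omega)
    _ = ENNReal.ofReal (M * ℓ⁻¹ * ℓ⁻¹ ^ j) := by rw [pow_succ, mul_assoc, mul_comm (ℓ⁻¹ ^ j)]

/-- The multiplication map `ℝ × ℝ → ℝ` has operator norm at most one. [folklore] -/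
theorem enorm_mul_le_one : ‖(ContinuousLinearMap.mul ℝ ℝ : ℝ →L[ℝ] ℝ →L[ℝ] ℝ)‖ₑ ≤ 1 := by
  rw [← ofReal_norm, ← ENNReal.ofReal_one]
  exact ENNReal.ofReal_le_ofReal (ContinuousLinearMap.opNorm_mul_le ℝ ℝ)

/-- **Leibniz for scaled bounds**: `‖fg‖_{C^k} ≤ 3^k ∑_{j≤k} ‖f‖_j ‖g‖_{k-j} ≤ 3^N (N+1) M₁ M₂ ℓ^{-k}`.
[cite: BuckmasterEtAl2018, App. A (A.2)] -/
theorem ScaledBound.mul (hf : ScaledBound f N ℓ M₁) (hg : ScaledBound g N ℓ M₂) (hfs : IsSmooth f)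
    (hgs : IsSmooth g) (h₁ : 0 ≤ M₁) (h₂ : 0 ≤ M₂) (hℓ : 0 < ℓ) :
    ScaledBound (fun x => f x * g x) N ℓ (3 ^ N * (N + 1) * M₁ * M₂) := by
  intro k hk
  have hli : 0 ≤ ℓ⁻¹ := inv_nonneg.2 hℓ.le
  set X : ℝ := M₁ * M₂ * ℓ⁻¹ ^ k with hXdef
  have hX : 0 ≤ X := mul_nonneg (mul_nonneg h₁ h₂) (pow_nonneg hli k)
  have hB := Torus.eContDiffHolderNorm_bilinear_le (ContinuousLinearMap.mul ℝ ℝ)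
    (hfs.isContDiff (n := (k : ℕ)) (by exact_mod_cast le_top))
    (hgs.isContDiff (n := (k : ℕ)) (by exact_mod_cast le_top)) 0
  -- each term of the Leibniz sum is at most `X`
  have hterm : ∀ j ∈ Finset.range (k + 1), Torus.eContDiffHolderNorm j 0 f *
      Torus.eContDiffHolderNorm (k - j) 0 g ≤ ENNReal.ofReal X := by
    intro j hj
    have hjk : j ≤ k := Nat.lt_succ_iff.1 (Finset.mem_range.1 hj)
    calc Torus.eContDiffHolderNorm j 0 f * Torus.eContDiffHolderNorm (k - j) 0 g
        ≤ ENNReal.ofReal (M₁ * ℓ⁻¹ ^ j) * ENNReal.ofReal (M₂ * ℓ⁻¹ ^ (k - j)) :=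
          mul_le_mul' (hf j (hjk.trans hk)) (hg (k - j) ((Nat.sub_le k j).trans hk))
      _ = ENNReal.ofReal X := by
          rw [← ENNReal.ofReal_mul (mul_nonneg h₁ (pow_nonneg hli j)), hXdef]
          congr 1
          rw [show ℓ⁻¹ ^ k = ℓ⁻¹ ^ j * ℓ⁻¹ ^ (k - j) by rw [← pow_add, Nat.add_sub_cancel' hjk]]
          ring
  have hsum : ∑ j ∈ Finset.range (k + 1), Torus.eContDiffHolderNorm j 0 f *
      Torus.eContDiffHolderNorm (k - j) 0 g ≤ (k + 1 : ℕ) * ENNReal.ofReal X := by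
    refine (Finset.sum_le_sum hterm).trans ?_
    rw [Finset.sum_const, Finset.card_range, nsmul_eq_mul]
  calc Torus.eContDiffHolderNorm k 0 (fun x => f x * g x)
      = Torus.eContDiffHolderNorm k 0 (fun x => ContinuousLinearMap.mul ℝ ℝ (f x) (g x)) := rfl
    _ ≤ 3 ^ k * ‖(ContinuousLinearMap.mul ℝ ℝ : ℝ →L[ℝ] ℝ →L[ℝ] ℝ)‖ₑ *
          ∑ j ∈ Finset.range (k + 1), Torus.eContDiffHolderNorm j 0 f *
            Torus.eContDiffHolderNorm (k - j) 0 g := hB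
    _ ≤ 3 ^ k * 1 * ((k + 1 : ℕ) * ENNReal.ofReal X) := by
        gcongr
        exact enorm_mul_le_one
    _ = ENNReal.ofReal (3 ^ k * (k + 1) * X) := by
        have e1 : ENNReal.ofReal ((3 : ℝ) ^ k * (k + 1) * X) =
            ENNReal.ofReal ((3 : ℝ) ^ k * (k + 1)) * ENNReal.ofReal X :=
          ENNReal.ofReal_mul (by positivity)
        have e2 : ENNReal.ofReal ((3 : ℝ) ^ k * (k + 1)) = (3 : ℝ≥0∞) ^ k * ((k + 1 : ℕ) : ℝ≥0∞) := by
          rw [ENNReal.ofReal_mul (by positivity), ENNReal.ofReal_pow (by norm_num), ENNReal.ofReal_ofNat,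
            show ((k : ℝ) + 1) = ((k + 1 : ℕ) : ℝ) by push_cast; ring, ENNReal.ofReal_natCast]
        rw [e1, e2, mul_one, mul_assoc]
    _ ≤ ENNReal.ofReal (3 ^ N * (N + 1) * M₁ * M₂ * ℓ⁻¹ ^ k) := by
        refine ENNReal.ofReal_le_ofReal ?_
        rw [hXdef, show (3 : ℝ) ^ N * (N + 1) * M₁ * M₂ * ℓ⁻¹ ^ k =
          3 ^ N * (N + 1) * (M₁ * M₂ * ℓ⁻¹ ^ k) by ring]
        have hkN : (k : ℝ) + 1 ≤ N + 1 := by exact_mod_cast Nat.succ_le_succ hk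
        have h3 : (3 : ℝ) ^ k ≤ 3 ^ N := pow_le_pow_right₀ (by norm_num) hk
        have h3k : (0 : ℝ) ≤ 3 ^ k := by positivity
        nlinarith [mul_le_mul h3 hkN (by positivity) (by positivity), hX]

end Scaled

/-! ## Descendants of a profile and their uniform bounds -/

section Descendants

/-- The profiles reached from `u` by `K` rounds of "take a zero-mean primitive `Tⱼ`, possibly
followed by one `R`-derivative `∂_{R_{ab}}`" — the profiles met in `K` integrations by parts. [folklore] -/
def descSet : ℕ → (𝕄 → 𝕋³ → ℝ) → Set (𝕄 → 𝕋³ → ℝ)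
  | 0, u => {u}
  | K + 1, u => ⋃ j : Fin 3, (descSet K (fun R => torusPrim (u R) j) ∪
      ⋃ a : Fin 3, ⋃ b : Fin 3, descSet K (dR (Matrix.single a b 1) fun R => torusPrim (u R) j))

variable {u v : 𝕄 → 𝕋³ → ℝ} {K : ℕ}

/-- Level `0`: only `u` itself. [folklore] -/
theorem mem_descSet_zero : v ∈ descSet 0 u ↔ v = u := by
  simp [descSet]

/-- Descendants of `Tⱼ u` are descendants of `u`, one level up. [folklore] -/
theorem descSet_prim_subset (u : 𝕄 → 𝕋³ → ℝ) (K : ℕ) (j : Fin 3) :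
    descSet K (fun R => torusPrim (u R) j) ⊆ descSet (K + 1) u := by
  intro v hv
  simp only [descSet, Set.mem_iUnion, Set.mem_union]
  exact ⟨j, Or.inl hv⟩

/-- Descendants of `∂_{R_{ab}} Tⱼ u` are descendants of `u`, one level up. [folklore] -/
theorem descSet_dR_prim_subset (u : 𝕄 → 𝕋³ → ℝ) (K : ℕ) (j a b : Fin 3) :
    descSet K (dR (Matrix.single a b 1) fun R => torusPrim (u R) j) ⊆ descSet (K + 1) u := by
  intro v hv
  simp only [descSet, Set.mem_iUnion, Set.mem_union]
  exact ⟨j, Or.inr ⟨a, b, hv⟩⟩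

/-- **Descendants of a jointly smooth profile are uniformly bounded on compact parameter sets**
(finitely many jointly smooth, hence continuous, functions on the compact `𝒦 × T³`). [folklore] -/
theorem exists_bound_descSet {Kset : Set 𝕄} (hK : IsCompact Kset) :
    ∀ (K : ℕ) (u : 𝕄 → 𝕋³ → ℝ), JointSmooth u →
      ∃ U : ℝ, 0 ≤ U ∧ ∀ v ∈ descSet K u, ∀ R ∈ Kset, ∀ ξ, |v R ξ| ≤ U := by
  intro K
  induction K with
  | zero =>
    intro u hu
    obtain ⟨C, hC⟩ := (hK.prod isCompact_univ).exists_bound_of_continuousOn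
      (f := fun p : 𝕄 × 𝕋³ => u p.1 p.2) hu.continuous.continuousOn
    refine ⟨max C 0, le_max_right _ _, fun v hv R hR ξ => ?_⟩
    rw [mem_descSet_zero.1 hv]
    have h := hC (R, ξ) ⟨hR, Set.mem_univ _⟩
    rw [Real.norm_eq_abs] at h
    exact h.trans (le_max_left _ _)
  | succ K ih =>
    intro u hu
    have hT : ∀ j, JointSmooth fun R => torusPrim (u R) j := fun j => hu.torusPrim j
    have hTR : ∀ j a b, JointSmooth (dR (Matrix.single a b 1) fun R => torusPrim (u R) j) :=
      fun j a b => (hT j).dR _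
    choose U₁ hU₁0 hU₁ using fun j => ih _ (hT j)
    choose U₂ hU₂0 hU₂ using fun j a b => ih _ (hTR j a b)
    refine ⟨∑ j, (U₁ j + ∑ a, ∑ b, U₂ j a b), Finset.sum_nonneg fun j _ =>
      add_nonneg (hU₁0 j) (Finset.sum_nonneg fun a _ => Finset.sum_nonneg fun b _ => hU₂0 j a b),
      fun v hv R hR ξ => ?_⟩
    simp only [descSet, Set.mem_iUnion, Set.mem_union] at hv
    obtain ⟨j, hv | ⟨a, b, hv⟩⟩ := hv
    · refine (hU₁ j v hv R hR ξ).trans ?_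
      refine le_trans ?_ (Finset.single_le_sum (f := fun j => U₁ j + ∑ a, ∑ b, U₂ j a b)
        (fun j _ => add_nonneg (hU₁0 j)
          (Finset.sum_nonneg fun a _ => Finset.sum_nonneg fun b _ => hU₂0 j a b)) (Finset.mem_univ j))
      exact le_add_of_nonneg_right (Finset.sum_nonneg fun a _ => Finset.sum_nonneg fun b _ => hU₂0 j a b)
    · refine (hU₂ j a b v hv R hR ξ).trans ?_
      refine le_trans ?_ (Finset.single_le_sum (f := fun j => U₁ j + ∑ a, ∑ b, U₂ j a b)
        (fun j _ => add_nonneg (hU₁0 j)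
          (Finset.sum_nonneg fun a _ => Finset.sum_nonneg fun b _ => hU₂0 j a b)) (Finset.mem_univ j))
      refine le_add_of_nonneg_of_le (hU₁0 j) ?_
      refine le_trans ?_ (Finset.single_le_sum (f := fun a => ∑ b, U₂ j a b)
        (fun a _ => Finset.sum_nonneg fun b _ => hU₂0 j a b) (Finset.mem_univ a))
      exact Finset.single_le_sum (f := fun b => U₂ j a b) (fun b _ => hU₂0 j a b) (Finset.mem_univ b)

end Descendants

/-! ## The non-stationary phase bound -/

section Main

variable {Rt : 𝕋³ → 𝕄} {D : 𝕋³ → ℝ³} {n K₀ : ℕ} {ℓ Λ : ℝ} {Kset : Set 𝕄}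

/-- The combinatorial constant `90 (3^{K₀+1}(K₀+2))²` of the `K₀`-fold integration by parts. [folklore] -/
def phaseConst (K₀ : ℕ) : ℝ := 90 * ((3 : ℝ) ^ (K₀ + 1) * (K₀ + 2)) ^ 2

/-- `phaseConst K₀ ≥ 0`. [folklore] -/
theorem phaseConst_nonneg (K₀ : ℕ) : 0 ≤ phaseConst K₀ := by
  unfold phaseConst
  positivity

/-- **The frame of the non-stationary phase bound**: a smooth matrix field `R̃` with values in a
compact set `𝒦`, a smooth displacement `D` with `det ∇Φ = 1` (`Φ = id + D`), a frequency
`n ≥ 1`, a length `ℓ ∈ (0,1]` and a level `K₀`, with the scaled bounds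
`‖(adj ∇Φ)_{mj}‖_{C^k}, ‖R̃_{ab}‖_{C^k} ≤ Λ ℓ^{-k}` for `k ≤ K₀` (`Λ ≥ 1`) — the content of
BDSV Prop. 5.7 (arXiv (5.23)–(5.24)) for `∇Φ_i⁻¹` and `R̃_{q,i}`.
[cite: BuckmasterEtAl2018, Prop. 5.7 (arXiv (5.23)–(5.24))] -/
structure PhaseFrame (Rt : 𝕋³ → 𝕄) (D : 𝕋³ → ℝ³) (n K₀ : ℕ) (ℓ Λ : ℝ) (Kset : Set 𝕄) : Prop where
  /-- `R̃` is smooth. -/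
  smooth_Rt : IsSmooth Rt
  /-- `D` is smooth. -/
  smooth_D : IsSmooth D
  /-- `n ≥ 1`. -/
  n_pos : 0 < n
  /-- `ℓ > 0`. -/
  ℓ_pos : 0 < ℓ
  /-- `ℓ ≤ 1`. -/
  ℓ_le_one : ℓ ≤ 1
  /-- `Λ ≥ 1`. -/
  one_le_Λ : 1 ≤ Λ
  /-- `det ∇Φ = 1`. -/
  det_jac : ∀ x, (jac D x).det = 1
  /-- `‖(adj ∇Φ)_{mj}‖_{C^k} ≤ Λ ℓ^{-k}`, `k ≤ K₀`. -/
  adj_bound : ∀ m j, ScaledBound (fun x => (jac D x).adjugate m j) K₀ ℓ Λ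
  /-- `‖R̃_{ab}‖_{C^k} ≤ Λ ℓ^{-k}`, `k ≤ K₀`. -/
  Rt_bound : ∀ a b, ScaledBound (fun x => Rt x a b) K₀ ℓ Λ
  /-- `𝒦` is compact. -/
  isCompact : IsCompact Kset
  /-- `R̃` takes values in `𝒦`. -/
  mem : ∀ x, Rt x ∈ Kset

/-- **The level-`K` bound** with factor `X`: for every jointly smooth zero-mean profile `u`, every
smooth amplitude `f` with `‖f‖_{C^k} ≤ F ℓ^{-k}` (`k ≤ K`) and every uniform bound `U` of the
level-`K` descendants of `u` on `𝒦 × T³`, `|∫ f c_u| ≤ X^K F U`. [folklore] -/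
def LevelBound (Rt : 𝕋³ → 𝕄) (D : 𝕋³ → ℝ³) (n : ℕ) (ℓ : ℝ) (Kset : Set 𝕄) (X : ℝ) (K : ℕ) : Prop :=
  ∀ (u : 𝕄 → 𝕋³ → ℝ) (f : 𝕋³ → ℝ) (F U : ℝ), JointSmooth u → (∀ R, ∫ ξ, u R ξ = 0) → IsSmooth f →
    0 ≤ F → ScaledBound f K ℓ F → 0 ≤ U → (∀ v ∈ descSet K u, ∀ R ∈ Kset, ∀ ξ, |v R ξ| ≤ U) →
      |∫ x, f x * phaseComp u Rt D n x| ≤ X ^ K * F * U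

/-- **Level `0`**: `|∫ f c_u| ≤ ‖f‖_∞ ‖c_u‖_∞ ≤ F U` (the torus has total mass one). [folklore] -/
theorem PhaseFrame.levelBound_zero (hP : PhaseFrame Rt D n K₀ ℓ Λ Kset) (X : ℝ) :
    LevelBound Rt D n ℓ Kset X 0 := by
  intro u f F U _ _ _ hF hfB _ hU
  rw [pow_zero, one_mul]
  have hpt : ∀ x, ‖f x * phaseComp u Rt D n x‖ ≤ F * U := by
    intro x
    rw [Real.norm_eq_abs, abs_mul]
    exact mul_le_mul (hfB.abs_le hF x) (hU u (mem_descSet_zero.2 rfl) (Rt x) (hP.mem x) _)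
      (abs_nonneg _) hF
  have h := norm_integral_le_of_norm_le_const (μ := (volume : Measure 𝕋³)) (Eventually.of_forall hpt)
  rw [Real.norm_eq_abs] at h
  simpa using h

/-- **The inductive step**: one round of "decompose `u = ∑ⱼ ∂ⱼ Tⱼu`, integrate by parts once"
improves the level-`K` bound with factor `X` by the factor `phaseConst K₀ · Λ² · (nℓ)⁻¹`.
[cite: BuckmasterEtAl2018, App. C Prop. C.2 (proof of (C.1))] -/
theorem PhaseFrame.levelBound_step (hP : PhaseFrame Rt D n K₀ ℓ Λ Kset) {K : ℕ} (hK : K + 1 ≤ K₀)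
    {X : ℝ} (hX : 0 ≤ X) (ih : LevelBound Rt D n ℓ Kset X K)
    (u : 𝕄 → 𝕋³ → ℝ) (f : 𝕋³ → ℝ) (F U : ℝ) (hu : JointSmooth u) (h0 : ∀ R, ∫ ξ, u R ξ = 0)
    (hf : IsSmooth f) (hF : 0 ≤ F) (hfB : ScaledBound f (K + 1) ℓ F) (hU0 : 0 ≤ U)
    (hU : ∀ v ∈ descSet (K + 1) u, ∀ R ∈ Kset, ∀ ξ, |v R ξ| ≤ U) :
    |∫ x, f x * phaseComp u Rt D n x| ≤
      X ^ K * (phaseConst K₀ * Λ ^ 2 * ((n : ℝ) * ℓ)⁻¹) * F * U := by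
  -- constants
  have hℓ := hP.ℓ_pos
  have hli : 0 ≤ ℓ⁻¹ := inv_nonneg.2 hℓ.le
  have hΛ0 : 0 ≤ Λ := zero_le_one.trans hP.one_le_Λ
  have hn0 : n ≠ 0 := hP.n_pos.ne'
  have hnr : (0 : ℝ) < n := Nat.cast_pos.2 hP.n_pos
  set c₀ : ℝ := (3 : ℝ) ^ (K₀ + 1) * (K₀ + 2) with hc₀def
  have hc₀1 : 1 ≤ c₀ := by
    have h3 : (1 : ℝ) ≤ 3 ^ (K₀ + 1) := one_le_pow₀ (by norm_num)
    have hK2 : (1 : ℝ) ≤ K₀ + 2 := by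
      have : (0 : ℝ) ≤ K₀ := Nat.cast_nonneg _
      linarith
    nlinarith
  have hc₀0 : 0 ≤ c₀ := zero_le_one.trans hc₀1
  have hKle : K ≤ K₀ := (Nat.le_succ K).trans hK
  have hc₁ : (3 : ℝ) ^ (K + 1) * ((K + 1 : ℕ) + 1) ≤ c₀ := by
    have h3 : (3 : ℝ) ^ (K + 1) ≤ 3 ^ (K₀ + 1) := pow_le_pow_right₀ (by norm_num) (by omega)
    have h4 : ((K + 1 : ℕ) : ℝ) + 1 ≤ K₀ + 2 := by
      have : ((K + 1 : ℕ) : ℝ) ≤ K₀ := by exact_mod_cast hK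
      linarith
    exact mul_le_mul h3 h4 (by positivity) (by positivity)
  have hc₂ : (3 : ℝ) ^ K * (K + 1) ≤ c₀ := by
    have h3 : (3 : ℝ) ^ K ≤ 3 ^ (K₀ + 1) := pow_le_pow_right₀ (by norm_num) (by omega)
    have h4 : (K : ℝ) + 1 ≤ K₀ + 2 := by
      have : (K : ℝ) ≤ K₀ := by exact_mod_cast hKle
      linarith
    exact mul_le_mul h3 h4 (by positivity) (by positivity)
  -- the uniform bound `T` for each of the ninety integrals
  set T : ℝ := X ^ K * (c₀ ^ 2 * F * Λ ^ 2 * ℓ⁻¹) * U with hTdef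
  have hT0 : 0 ≤ T := by positivity
  -- the primitives `w j = T_j u`
  set w : Fin 3 → 𝕄 → 𝕋³ → ℝ := fun j R => torusPrim (u R) j with hwdef
  have hw : ∀ j, JointSmooth (w j) := fun j => hu.torusPrim j
  have hw0 : ∀ j R, ∫ ξ, w j R ξ = 0 := fun j R => integral_torusPrim (hu.isSmooth R) j
  have hwR : ∀ j a b, JointSmooth (dR (Matrix.single a b 1) (w j)) := fun j a b => (hw j).dR _
  have hwR0 : ∀ j a b R, ∫ ξ, dR (Matrix.single a b 1) (w j) R ξ = 0 := fun j a b R =>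
    (hw j).integral_dR (hw0 j) _ R
  -- smoothness of the amplitudes
  have hA : ∀ m j, IsSmooth fun x => (jac D x).adjugate m j := fun m j =>
    isSmooth_adjugate_jac_entry hP.smooth_D m j
  have hfA : ∀ m j, IsSmooth fun x => f x * (jac D x).adjugate m j := fun m j =>
    hf.mul (hA m j)
  have hRab : ∀ m a b, IsSmooth fun x => partialDeriv m (fun y => Rt y a b) x := fun m a b =>
    (isSmooth_entry hP.smooth_Rt a b).partialDeriv m
  -- scaled bounds of the amplitudes
  have hB1 : ∀ m j, ScaledBound (partialDeriv m fun y => f y * (jac D y).adjugate m j) K ℓ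
      (3 ^ (K + 1) * ((K + 1 : ℕ) + 1) * F * Λ * ℓ⁻¹) := fun m j =>
    (hfB.mul ((hP.adj_bound m j).mono_N hK) hf (hA m j) hF hΛ0 hℓ).partialDeriv (hfA m j) m
  have hB2 : ∀ m j a b, ScaledBound
      (fun x => f x * (jac D x).adjugate m j * partialDeriv m (fun y => Rt y a b) x) K ℓ
      (3 ^ K * (K + 1) * (3 ^ K * (K + 1) * F * Λ) * (Λ * ℓ⁻¹)) := by
    intro m j a b
    have h1 : ScaledBound (fun x => f x * (jac D x).adjugate m j) K ℓ (3 ^ K * (K + 1) * F * Λ) :=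
      (hfB.mono_N (Nat.le_succ K)).mul ((hP.adj_bound m j).mono_N hKle) hf (hA m j) hF hΛ0 hℓ
    have h2 : ScaledBound (partialDeriv m fun y => Rt y a b) K ℓ (Λ * ℓ⁻¹) :=
      ((hP.Rt_bound a b).mono_N hK).partialDeriv (isSmooth_entry hP.smooth_Rt a b) m
    exact h1.mul h2 (hfA m j) (hRab m a b) (by positivity) (by positivity) hℓ
  -- the two kinds of integrals are bounded by `T`
  have hI1 : ∀ m j, |∫ x, partialDeriv m (fun y => f y * (jac D y).adjugate m j) x *
      phaseComp (w j) Rt D n x| ≤ T := by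
    intro m j
    have h := ih (w j) _ _ U (hw j) (hw0 j) ((hfA m j).partialDeriv m) (by positivity) (hB1 m j) hU0
      (fun v hv R hR ξ => hU v (descSet_prim_subset u K j hv) R hR ξ)
    refine h.trans ?_
    rw [hTdef]
    have hXK : 0 ≤ X ^ K := pow_nonneg hX K
    have key : (3 : ℝ) ^ (K + 1) * ((K + 1 : ℕ) + 1) * F * Λ * ℓ⁻¹ ≤ c₀ ^ 2 * F * Λ ^ 2 * ℓ⁻¹ := by
      have h1 : (3 : ℝ) ^ (K + 1) * ((K + 1 : ℕ) + 1) * F * Λ * ℓ⁻¹ ≤ c₀ * F * Λ * ℓ⁻¹ := by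
        have : 0 ≤ F * Λ * ℓ⁻¹ := by positivity
        nlinarith
      have h2 : c₀ * F * Λ * ℓ⁻¹ ≤ c₀ ^ 2 * F * Λ ^ 2 * ℓ⁻¹ := by
        have : c₀ * Λ ≤ c₀ ^ 2 * Λ ^ 2 := by nlinarith [mul_le_mul hc₀1 hP.one_le_Λ zero_le_one hc₀0]
        have : 0 ≤ F * ℓ⁻¹ := by positivity
        nlinarith
      exact h1.trans h2
    have := mul_le_mul_of_nonneg_left key hXK
    nlinarith [mul_le_mul_of_nonneg_right this hU0]
  have hI2 : ∀ m j a b, |∫ x, (f x * (jac D x).adjugate m j * partialDeriv m (fun y => Rt y a b) x) *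
      phaseComp (dR (Matrix.single a b 1) (w j)) Rt D n x| ≤ T := by
    intro m j a b
    have h := ih (dR (Matrix.single a b 1) (w j)) _ _ U (hwR j a b) (hwR0 j a b)
      ((hfA m j).mul (hRab m a b)) (by positivity) (hB2 m j a b) hU0
      (fun v hv R hR ξ => hU v (descSet_dR_prim_subset u K j a b hv) R hR ξ)
    refine h.trans ?_
    rw [hTdef]
    have hXK : 0 ≤ X ^ K := pow_nonneg hX K
    have key : (3 : ℝ) ^ K * (K + 1) * (3 ^ K * (K + 1) * F * Λ) * (Λ * ℓ⁻¹) ≤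
        c₀ ^ 2 * F * Λ ^ 2 * ℓ⁻¹ := by
      have e : (3 : ℝ) ^ K * (K + 1) * (3 ^ K * (K + 1) * F * Λ) * (Λ * ℓ⁻¹) =
          (3 ^ K * (K + 1)) ^ 2 * (F * Λ ^ 2 * ℓ⁻¹) := by ring
      rw [e, show c₀ ^ 2 * F * Λ ^ 2 * ℓ⁻¹ = c₀ ^ 2 * (F * Λ ^ 2 * ℓ⁻¹) by ring]
      have : 0 ≤ F * Λ ^ 2 * ℓ⁻¹ := by positivity
      have hsq : ((3 : ℝ) ^ K * (K + 1)) ^ 2 ≤ c₀ ^ 2 := pow_le_pow_left₀ (by positivity) hc₂ 2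
      nlinarith
    have := mul_le_mul_of_nonneg_left key hXK
    nlinarith [mul_le_mul_of_nonneg_right this hU0]
  -- decompose `u = ∑ⱼ ∂ⱼ (w j)` along the phase and split the integral
  have hdec : (fun x => f x * phaseComp u Rt D n x) =
      fun x => ∑ j, f x * phaseComp (dXi j (w j)) Rt D n x := by
    funext x
    rw [← Finset.mul_sum]
    congr 1
    exact eq_sum_partialDeriv_torusPrim (hu.isSmooth (Rt x)) (h0 (Rt x)) _
  have hint : ∀ j, Integrable fun x => f x * phaseComp (dXi j (w j)) Rt D n x := fun j =>
    (hf.mul (((hw j).dXi j).phaseComp hP.smooth_Rt hP.smooth_D n)).integrable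
  rw [hdec, integral_finsetSum _ fun j _ => hint j]
  -- each summand after one integration by parts
  have hj : ∀ j, |∫ x, f x * phaseComp (dXi j (w j)) Rt D n x| ≤ (n : ℝ)⁻¹ * (30 * T) := by
    intro j
    rw [integral_mul_phaseComp_dXi (hw j) hP.smooth_Rt hP.smooth_D hP.det_jac hf hn0 j, abs_neg,
      abs_mul, abs_of_pos (inv_pos.2 hnr)]
    refine mul_le_mul_of_nonneg_left ?_ (inv_nonneg.2 hnr.le)
    refine (abs_add_le _ _).trans ?_
    have h1 : |∑ m, ∫ x, partialDeriv m (fun y => f y * (jac D y).adjugate m j) x *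
        phaseComp (w j) Rt D n x| ≤ 3 * T := by
      refine (Finset.abs_sum_le_sum_abs _ _).trans ?_
      refine (Finset.sum_le_sum fun m _ => hI1 m j).trans ?_
      simp
    have h2 : |∑ m, ∑ a, ∑ b, ∫ x, (f x * (jac D x).adjugate m j *
        partialDeriv m (fun y => Rt y a b) x) * phaseComp (dR (Matrix.single a b 1) (w j)) Rt D n x|
        ≤ 27 * T := by
      refine (Finset.abs_sum_le_sum_abs _ _).trans ?_
      have h3 : ∀ m, |∑ a, ∑ b, ∫ x, (f x * (jac D x).adjugate m j *
          partialDeriv m (fun y => Rt y a b) x) * phaseComp (dR (Matrix.single a b 1) (w j)) Rt D n x|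
          ≤ 9 * T := by
        intro m
        refine (Finset.abs_sum_le_sum_abs _ _).trans ?_
        have h4 : ∀ a, |∑ b, ∫ x, (f x * (jac D x).adjugate m j *
            partialDeriv m (fun y => Rt y a b) x) * phaseComp (dR (Matrix.single a b 1) (w j)) Rt D n x|
            ≤ 3 * T := by
          intro a
          refine (Finset.abs_sum_le_sum_abs _ _).trans ?_
          refine (Finset.sum_le_sum fun b _ => hI2 m j a b).trans ?_
          simp
        refine (Finset.sum_le_sum fun a _ => h4 a).trans ?_
        simp only [Finset.sum_const, Finset.card_univ, Fintype.card_fin, nsmul_eq_mul]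
        norm_num
        linarith
      refine (Finset.sum_le_sum fun m _ => h3 m).trans ?_
      simp only [Finset.sum_const, Finset.card_univ, Fintype.card_fin, nsmul_eq_mul]
      norm_num
      linarith
    linarith
  refine (Finset.abs_sum_le_sum_abs _ _).trans ?_
  refine (Finset.sum_le_sum fun j _ => hj j).trans ?_
  simp only [Finset.sum_const, Finset.card_univ, Fintype.card_fin, nsmul_eq_mul, Nat.cast_ofNat]
  rw [hTdef, phaseConst, ← hc₀def]
  apply le_of_eq
  ring

/-- **The non-stationary phase bound** (the mechanism of BDSV App. C, Prop. C.2 (C.1):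
`|∫ a e^{ik·Φ}| ≲ (‖a‖_N + ‖a‖₀‖Φ‖_N)/|k|^N`, here in scaled form): in a phase frame of level
`K₀`, for every `K ≤ K₀`, every jointly smooth zero-mean profile `u` on `ℝ^{3×3} × T³`, every
smooth amplitude `f` with `‖f‖_{C^k} ≤ F ℓ^{-k}` (`k ≤ K`) and every uniform bound `U` of the
level-`K` descendants of `u` on `𝒦 × T³`,
`|∫_{T³} f(x) u(R̃(x), n Φ(x)) dx| ≤ (phaseConst K₀ · Λ² · (nℓ)⁻¹)^K · F · U`.
[cite: BuckmasterEtAl2018, App. C Prop. C.2 (C.1)] -/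
theorem PhaseFrame.levelBound (hP : PhaseFrame Rt D n K₀ ℓ Λ Kset) :
    ∀ K ≤ K₀, LevelBound Rt D n ℓ Kset (phaseConst K₀ * Λ ^ 2 * ((n : ℝ) * ℓ)⁻¹) K := by
  have hX : 0 ≤ phaseConst K₀ * Λ ^ 2 * ((n : ℝ) * ℓ)⁻¹ :=
    mul_nonneg (mul_nonneg (phaseConst_nonneg K₀) (sq_nonneg Λ))
      (inv_nonneg.2 (mul_nonneg (Nat.cast_nonneg n) hP.ℓ_pos.le))
  intro K
  induction K with
  | zero => exact fun _ => hP.levelBound_zero _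
  | succ K ihK =>
    intro hK u f F U hu h0 hf hF hfB hU0 hU
    have h := hP.levelBound_step hK hX (ihK ((Nat.le_succ K).trans hK)) u f F U hu h0 hf hF hfB hU0 hU
    rw [pow_succ]
    linarith [h]

end Main

end BDSV

end Literature.Analysis.FluidPDE
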